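import Summits.QuantumAdvantage.QuantumAdvantage.Theorems.CubicForrelationNearExactIsExactSixteenLevelEightPrep

/-!
# Crux `CubicForrelation.NearExactIsExact` (stmt-QuantumAdvantage-14043) — n = 16, TWO-SIDED: the level-8 boundary configuration is not
  realizable (`W_g ∈ 256ℤ` and `Φ ≥ 31/32` force `Φ = 1`)

Certificate seat `b2b-cforr-cert` (gen 4).  HONEST FRAMING: a theorem about cubic Boolean functions on 16 bits (the finite slice `n = 16` of
the crux) — the boundary configuration (c) "level 8" of the certified bound `θ₁₆ ≤ 31/32` is excluded two-sidedly; NOT summit progress and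
NOT yet the full statement `Φ ≥ 31/32 ⇒ Φ = 1` on 16 bits (level 7 and the split type-O configurations remain).

`se_levelEight_ge`: for cubic `f, g : 𝔽₂¹⁶ → 𝔽₂` with `W_g = 256·w` (all Walsh values divisible by `2⁸`) and `Φ(f,g) ≥ 31/32`: `Φ(f,g) = 1`.
Proof.  If every `w` is odd, Parseval forces `|W_g| = 256` everywhere (bent) and Hou + Reed–Muller give `Φ = 1` or `≤ 15/16`.  Otherwise the
even set `Z = {w even}` is the support of a non-zero function of degree `≤ 4` (tower), so `#Z ≥ 2¹²` (`RM(4,16)`), while the two-sided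
budget `Σ (w − (−1)^f)² = 2¹⁷(1 − Φ) ≤ 2¹²` pays `≥ 1` per even point: `#Z = 2¹²`, `w = (−1)^f` off `Z`, `w = (−1)^f ± 1` on `Z`, and `Z` is a
12-FLAT `x₁ ⊕ V₀` (`mw_flat_of_minweight`, minimum-weight words of `RM(4,16)`).  General 6-flat sums (`fs_flat_sum_dvd`, `16 ∣ Σ_ε W_g/64`)
over `x₁ ⊕ ⟨d₁,…,d₄,c,c'⟩` with `c, c' ∈ V₀` and four directions transversal to `V₀` (`se_dirs4`) show that `σ = w − (−1)^f` is a
`±`CHARACTER on `Z`; hence its transform has sixteen frequencies of modulus `2¹²` (`Σ|σ̂| = 2¹⁶`), while Walsh inversion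
`σ̂ = 256(−1)^g − W_f` and Parseval for `f` need `Σ (−1)^g σ̂ = 2¹⁹`. Contradiction.

References: J. Ax (1964) / R. J. McEliece (1972); MacWilliams–Sloane (1977) Ch. 13–15; R. O'Donnell (2014) §3.3; X.-D. Hou (1998); S. Aaronson,
A. Ambainis, SIAM J. Comput. 47 (2018) §1.1.1.  Everything below is proved from Mathlib and the tree; axioms are the standard three.
-/

set_option linter.dupNamespace false -- D-0017: single-problem summit ⇒ `QuantumAdvantage.QuantumAdvantage` by design

noncomputable section

namespace Summit.QuantumAdvantage.QuantumAdvantage.Theorems.CubicForrelation.NearExactIsExact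

open Finset
open Literature.Computability.QuantumComplexity
open Literature.Computability.QuantumComplexity.BuzetChailloux (bxor zeroVec bxor_bxor_cancel_left bxor_zeroVec zeroVec_bxor bxor_comm
  signOf_sq)
open Literature.Computability.QuantumComplexity.DerivativeWalsh (W sum_W_sq twist_bxor_left)

/-- **Level 8 on 16 bits: `Φ ≥ 31/32 ⇒ Φ = 1`.**  For cubic `f, g : 𝔽₂¹⁶ → 𝔽₂` with `W_g = 256·w` and `Φ(f,g) ≥ 31/32`, the pair is exact.
(Bent case: Hou; non-bent case: two-sided — the even set of `w` would be a 12-flat carrying a `±`character `w − (−1)^f`, sixteen frequencies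
of modulus `2¹²` against the Parseval-for-`f` pairing `2¹⁹`.)  Finite-slice statement; NOT summit progress. [this work] -/
theorem se_levelEight_ge (f g : (Fin (8 + 8) → Bool) → Bool) (hf : IsDegLeFun 3 f) (hg : IsDegLeFun 3 g)
    (w : (Fin (8 + 8) → Bool) → ℤ) (hw : ∀ x, W (fun y => signOf (g y)) x = (2 : ℝ) ^ 8 * (w x : ℝ))
    (hΦ : (31 / 32 : ℝ) ≤ forrelation f g) : forrelation f g = 1 := by
  classical
  -- Parseval: `Σ w² = 2¹⁶`
  have hPw : ∑ x, ((w x : ℝ)) ^ 2 = 65536 := by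
    have hP := st_parseval16 g
    rw [sum_congr rfl fun x _ => by rw [hw x]] at hP
    have e : ∀ x, ((2 : ℝ) ^ 8 * (w x : ℝ)) ^ 2 = 65536 * (w x : ℝ) ^ 2 := fun x => by ring
    rw [sum_congr rfl fun x _ => e x, ← mul_sum, show (2 : ℝ) ^ 32 = 65536 * 65536 by norm_num] at hP
    linarith
  -- bent case
  by_cases hall : ∀ x, Odd (w x)
  · have hsq1 : ∀ x, (w x : ℝ) ^ 2 = 1 := by
      have hnn : ∀ x, 0 ≤ (w x : ℝ) ^ 2 - 1 := by
        intro x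
        have h1 := Int.odd_iff.1 (hall x)
        have : w x ≤ -1 ∨ 1 ≤ w x := by omega
        have hz : (1 : ℤ) ≤ w x ^ 2 := by rcases this with h | h <;> nlinarith
        have : (1 : ℝ) ≤ (w x : ℝ) ^ 2 := by exact_mod_cast hz
        linarith
      have hs0 : ∑ x, ((w x : ℝ) ^ 2 - 1) = 0 := by
        rw [sum_sub_distrib, hPw, sum_const, card_univ, Fintype.card_fun, Fintype.card_bool, Fintype.card_fin]; norm_num
      intro x
      have := (sum_eq_zero_iff_of_nonneg fun y _ => hnn y).1 hs0 x (mem_univ x)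
      linarith
    have hbent : ∀ x, W (fun y => signOf (g y)) x ^ 2 = (2 : ℝ) ^ (8 + 8) := by
      intro x; rw [hw x, mul_pow, hsq1 x]; norm_num
    rcases tw_bent_end (by norm_num : 3 ≤ 8) f g hf hg hbent with h | h
    · exact h
    · exfalso; norm_num at h; linarith
  -- non-bent: the even set
  exfalso
  push Not at hall
  obtain ⟨x₁, hx₁⟩ := hall
  have hq : IsDegLeFun 4 (fun x => decide (Odd (w x))) :=
    stub_walshTower stub_axParity (8 + 8) 8 4 g w hg hw (by intro k hk hkn; omega)
  have hh : IsDegLeFun (3 + 1) (fun x => !decide (Odd (w x))) := by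
    have h := bb_isDegLeFun_bxor hq (isDegLeFun_const 4 true)
    refine (show (fun x => !decide (Odd (w x))) = (fun x => decide (Odd (w x)) ^^ true) from ?_) ▸ h
    funext x; cases decide (Odd (w x)) <;> rfl
  -- budget `Σ (w − s)² ≤ 2¹²`
  have hB : (∑ x, (w x - sZ (f x)) ^ 2 : ℤ) ≤ 4096 := by
    have h := se_budget8 f g w hw
    have h' : ((∑ x, (w x - sZ (f x)) ^ 2 : ℤ) : ℝ) ≤ 4096 := by rw [h]; nlinarith
    exact_mod_cast h'
  -- RM: `#Z ≥ 2¹²`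
  have hRM := bb_rmWeight_holds (8 + 8) 4 (fun x => !decide (Odd (w x))) hh ⟨x₁, by simpa using hx₁⟩
  have hfilt : (univ.filter fun x : Fin (8 + 8) → Bool => (!decide (Odd (w x))) = true) = univ.filter fun x => ¬ Odd (w x) :=
    filter_congr fun x _ => by simp
  have hZge : 4096 ≤ #(univ.filter fun x : Fin (8 + 8) → Bool => ¬ Odd (w x)) := by
    rw [hfilt] at hRM
    have h2 : (2 : ℕ) ^ (8 + 8) = 16 * 4096 := by norm_num
    have h3 : (2 : ℕ) ^ 4 = 16 := by norm_num
    rw [h2, h3] at hRM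
    omega
  -- the pointwise cost vanishes
  have hsumP : (∑ x, (if ¬ Odd (w x) then 1 else 0 : ℤ)) = #(univ.filter fun x : Fin (8 + 8) → Bool => ¬ Odd (w x)) := by
    rw [sum_boole]
  have hnonneg : ∀ x, 0 ≤ (w x - sZ (f x)) ^ 2 - (if ¬ Odd (w x) then 1 else 0 : ℤ) := by
    intro x
    by_cases h : Odd (w x)
    · rw [if_neg (not_not.2 h)]
      have := sq_nonneg (w x - sZ (f x)); linarith
    · rw [if_pos h]
      -- even minus odd is odd
      have he : Even (w x) := Int.not_odd_iff_even.1 h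
      have h0 := Int.even_iff.1 he
      have : w x - sZ (f x) ≤ -1 ∨ 1 ≤ w x - sZ (f x) := by
        rcases tp_sZ_cases (f x) with hs | hs <;> rw [hs] <;> omega
      have := tp_sq_ge (k := 1) (by norm_num) this
      linarith
  have hsum0 : ∑ x, ((w x - sZ (f x)) ^ 2 - (if ¬ Odd (w x) then 1 else 0 : ℤ)) = 0 := by
    refine le_antisymm ?_ (sum_nonneg fun x _ => hnonneg x)
    rw [sum_sub_distrib, hsumP]
    have : (4096 : ℤ) ≤ #(univ.filter fun x : Fin (8 + 8) → Bool => ¬ Odd (w x)) := by exact_mod_cast hZge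
    linarith
  have hzero' : ∀ x, (w x - sZ (f x)) ^ 2 - (if ¬ Odd (w x) then 1 else 0 : ℤ) = 0 :=
    fun x => (sum_eq_zero_iff_of_nonneg fun y _ => hnonneg y).1 hsum0 x (mem_univ x)
  have hoff : ∀ x, Odd (w x) → w x - sZ (f x) = 0 := by
    intro x hx
    have h := hzero' x
    rw [if_neg (not_not.2 hx), sub_zero] at h
    exact (pow_eq_zero_iff two_ne_zero).1 h
  have hon : ∀ x, ¬ Odd (w x) → w x - sZ (f x) = 1 ∨ w x - sZ (f x) = -1 := by
    intro x hx
    have h := hzero' x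
    rw [if_pos hx] at h
    have h1 : (w x - sZ (f x)) * (w x - sZ (f x)) = 1 := by rw [← pow_two]; linarith
    exact mul_self_eq_one_iff.1 h1
  have hZcard : #(univ.filter fun x : Fin (8 + 8) → Bool => ¬ Odd (w x)) = 4096 := by
    have hle : (#(univ.filter fun x : Fin (8 + 8) → Bool => ¬ Odd (w x)) : ℤ) ≤ 4096 := by
      rw [← hsumP]
      refine le_trans (sum_le_sum fun x _ => ?_) hB
      by_cases h : Odd (w x)
      · rw [if_neg (not_not.2 h)]; positivity
      · rw [if_pos h]; rcases hon x h with h1 | h1 <;> rw [h1] <;> norm_num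
    have hle' : #(univ.filter fun x : Fin (8 + 8) → Bool => ¬ Odd (w x)) ≤ 4096 := by exact_mod_cast hle
    omega
  -- the even set is a 12-flat
  have hmw := mw_flat_of_minweight 3 (fun x => !decide (Odd (w x))) hh (by rw [hfilt, hZcard]; norm_num)
  rw [hfilt] at hmw
  obtain ⟨h0, hadd, hcardV, hcoset⟩ := hmw
  set V₀ := univ.filter (fun a : Fin (8 + 8) → Bool => ∀ x, (!decide (Odd (w (bxor x a)))) = !decide (Odd (w x))) with hV₀
  have hPimg := hcoset x₁ (by simpa using hx₁)
  have hmemZ : ∀ x, x ∈ (univ.filter fun x : Fin (8 + 8) → Bool => ¬ Odd (w x)) ↔ ¬ Odd (w x) := by intro x; simp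
  have hin : ∀ z, ¬ Odd (w z) → ∀ c ∈ V₀, ¬ Odd (w (bxor z c)) := by
    intro z hz c hc
    have h := (mem_filter.1 hc).2 z
    have h' : decide (Odd (w (bxor z c))) = decide (Odd (w z)) := by
      revert h; cases decide (Odd (w (bxor z c))) <;> cases decide (Odd (w z)) <;> simp
    rw [decide_eq_decide] at h'
    exact fun hodd => hz (h'.1 hodd)
  have hout : ∀ z, ¬ Odd (w z) → ∀ t, t ∉ V₀ → Odd (w (bxor z t)) := by
    intro z hz t ht
    by_contra hzt
    apply ht
    have key := fl_coset_translate V₀ _ x₁ hadd hPimg ((hmemZ z).2 hz) h0 t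
    rw [bxor_zeroVec] at key
    exact key.1 ((hmemZ _).2 hzt)
  have hzero : ∀ p t : Fin (8 + 8) → Bool, ¬ Odd (w p) → t ∉ V₀ → w (bxor p t) - sZ (f (bxor p t)) = 0 :=
    fun p t hp ht => hoff _ (hout p hp t ht)
  -- four transversal directions
  have hcardV' : #V₀ ≤ 4096 := by rw [hcardV, hZcard]
  obtain ⟨d₁, d₂, d₃, d₄, t0, t1, t2, t3, t4, t5, t6, t7, t8, t9, t10, t11, t12, t13, t14⟩ := se_dirs4 V₀ hcardV'
  -- multiplicativity on the coset
  have hmul : ∀ c ∈ V₀, ∀ c' ∈ V₀,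
      (w (bxor x₁ (bxor c c')) - sZ (f (bxor x₁ (bxor c c')))) * (w x₁ - sZ (f x₁)) =
        (w (bxor x₁ c) - sZ (f (bxor x₁ c))) * (w (bxor x₁ c') - sZ (f (bxor x₁ c'))) := by
    intro c hc c' hc'
    have hu6 : ∀ x, W (fun y => signOf (g y)) x = (2 : ℝ) ^ 6 * ((4 * w x : ℤ) : ℝ) := by
      intro x; rw [hw x]; push_cast; ring
    have h16 := fs_flat_sum_dvd (e := 4) g (fun x => 4 * w x) hg hu6 x₁
      (Fin.cons d₁ (Fin.cons d₂ (Fin.cons d₃ (Fin.cons d₄ (Fin.cons c (Fin.cons c' (fun i : Fin 0 => i.elim0)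
        : Fin 1 → Fin (8 + 8) → Bool) : Fin 2 → Fin (8 + 8) → Bool) : Fin 3 → Fin (8 + 8) → Bool) : Fin 4 → Fin (8 + 8) → Bool)
        : Fin 5 → Fin (8 + 8) → Bool) : Fin 6 → Fin (8 + 8) → Bool) (by norm_num)
    obtain ⟨zf, hzf⟩ := fs_sum_signOf_flat_dvd f hf x₁
      (Fin.cons d₁ (Fin.cons d₂ (Fin.cons d₃ (Fin.cons d₄ (Fin.cons c (Fin.cons c' (fun i : Fin 0 => i.elim0)
        : Fin 1 → Fin (8 + 8) → Bool) : Fin 2 → Fin (8 + 8) → Bool) : Fin 3 → Fin (8 + 8) → Bool) : Fin 4 → Fin (8 + 8) → Bool)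
        : Fin 5 → Fin (8 + 8) → Bool) : Fin 6 → Fin (8 + 8) → Bool)
    have hsf : (16 : ℤ) ∣ ∑ ε : Fin 6 → Bool, 4 * sZ (f (fun j => x₁ j ^^ decide (Odd #(univ.filter fun i : Fin 6 => ε i &&
        (Fin.cons d₁ (Fin.cons d₂ (Fin.cons d₃ (Fin.cons d₄ (Fin.cons c (Fin.cons c' (fun i : Fin 0 => i.elim0)
        : Fin 1 → Fin (8 + 8) → Bool) : Fin 2 → Fin (8 + 8) → Bool) : Fin 3 → Fin (8 + 8) → Bool) : Fin 4 → Fin (8 + 8) → Bool)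
        : Fin 5 → Fin (8 + 8) → Bool) : Fin 6 → Fin (8 + 8) → Bool) i j)))) := by
      have hcast : ((∑ ε : Fin 6 → Bool, sZ (f (fun j => x₁ j ^^ decide (Odd #(univ.filter fun i : Fin 6 => ε i &&
          (Fin.cons d₁ (Fin.cons d₂ (Fin.cons d₃ (Fin.cons d₄ (Fin.cons c (Fin.cons c' (fun i : Fin 0 => i.elim0)
          : Fin 1 → Fin (8 + 8) → Bool) : Fin 2 → Fin (8 + 8) → Bool) : Fin 3 → Fin (8 + 8) → Bool) : Fin 4 → Fin (8 + 8) → Bool)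
          : Fin 5 → Fin (8 + 8) → Bool) : Fin 6 → Fin (8 + 8) → Bool) i j)))) : ℤ) : ℝ) = ((4 * zf : ℤ) : ℝ) := by
        push_cast
        rw [sum_congr rfl fun ε _ => tp_sZ_cast _, hzf]
        norm_num
      have hz : (∑ ε : Fin 6 → Bool, sZ (f (fun j => x₁ j ^^ decide (Odd #(univ.filter fun i : Fin 6 => ε i &&
          (Fin.cons d₁ (Fin.cons d₂ (Fin.cons d₃ (Fin.cons d₄ (Fin.cons c (Fin.cons c' (fun i : Fin 0 => i.elim0)
          : Fin 1 → Fin (8 + 8) → Bool) : Fin 2 → Fin (8 + 8) → Bool) : Fin 3 → Fin (8 + 8) → Bool) : Fin 4 → Fin (8 + 8) → Bool)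
          : Fin 5 → Fin (8 + 8) → Bool) : Fin 6 → Fin (8 + 8) → Bool) i j)))) : ℤ) = 4 * zf := by exact_mod_cast hcast
      rw [← mul_sum, hz]
      exact ⟨zf, by ring⟩
    have hσ16 : (16 : ℤ) ∣ ∑ ε : Fin 6 → Bool, (4 * w (fun j => x₁ j ^^ decide (Odd #(univ.filter fun i : Fin 6 => ε i &&
        (Fin.cons d₁ (Fin.cons d₂ (Fin.cons d₃ (Fin.cons d₄ (Fin.cons c (Fin.cons c' (fun i : Fin 0 => i.elim0)
        : Fin 1 → Fin (8 + 8) → Bool) : Fin 2 → Fin (8 + 8) → Bool) : Fin 3 → Fin (8 + 8) → Bool) : Fin 4 → Fin (8 + 8) → Bool)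
        : Fin 5 → Fin (8 + 8) → Bool) : Fin 6 → Fin (8 + 8) → Bool) i j))) -
        4 * sZ (f (fun j => x₁ j ^^ decide (Odd #(univ.filter fun i : Fin 6 => ε i &&
        (Fin.cons d₁ (Fin.cons d₂ (Fin.cons d₃ (Fin.cons d₄ (Fin.cons c (Fin.cons c' (fun i : Fin 0 => i.elim0)
        : Fin 1 → Fin (8 + 8) → Bool) : Fin 2 → Fin (8 + 8) → Bool) : Fin 3 → Fin (8 + 8) → Bool) : Fin 4 → Fin (8 + 8) → Bool)
        : Fin 5 → Fin (8 + 8) → Bool) : Fin 6 → Fin (8 + 8) → Bool) i j))))) := by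
      rw [sum_sub_distrib]
      exact dvd_sub h16 hsf
    have e4 : ∀ x, 4 * w x - 4 * sZ (f x) = 4 * (w x - sZ (f x)) := fun x => by ring
    simp only [e4] at hσ16
    rw [← mul_sum] at hσ16
    simp only [tep_sum_split, Fintype.sum_unique, se_pt_six, Bool.true_and, Bool.false_and, es_bxor_false,
      show (fun j => c j) = c from rfl, show (fun j => c' j) = c' from rfl, show (fun j => d₁ j) = d₁ from rfl,
      show (fun j => d₂ j) = d₂ from rfl, show (fun j => d₃ j) = d₃ from rfl, show (fun j => d₄ j) = d₄ from rfl] at hσ16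
    have o0 : ¬ Odd (w x₁) := hx₁
    have o1 : ¬ Odd (w (bxor x₁ c')) := hin _ hx₁ c' hc'
    have o2 : ¬ Odd (w (bxor x₁ c)) := hin _ hx₁ c hc
    have o3 : ¬ Odd (w (bxor (bxor x₁ c') c)) := hin _ o1 c hc
    have z0 : ∀ p : Fin (8 + 8) → Bool, ¬ Odd (w p) → w (bxor p d₄) - sZ (f (bxor p d₄)) = 0 := by
      intro p hp
      exact hzero p _ hp t0
    have z1 : ∀ p : Fin (8 + 8) → Bool, ¬ Odd (w p) → w (bxor p d₃) - sZ (f (bxor p d₃)) = 0 := by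
      intro p hp
      exact hzero p _ hp t1
    have z2 : ∀ p : Fin (8 + 8) → Bool, ¬ Odd (w p) → w (bxor p d₂) - sZ (f (bxor p d₂)) = 0 := by
      intro p hp
      exact hzero p _ hp t2
    have z3 : ∀ p : Fin (8 + 8) → Bool, ¬ Odd (w p) → w (bxor p d₁) - sZ (f (bxor p d₁)) = 0 := by
      intro p hp
      exact hzero p _ hp t3
    have z4 : ∀ p : Fin (8 + 8) → Bool, ¬ Odd (w p) → w (bxor (bxor p d₄) d₃) - sZ (f (bxor (bxor p d₄) d₃)) = 0 := by
      intro p hp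
      rw [iw_bxor_assoc]
      exact hzero p _ hp t4
    have z5 : ∀ p : Fin (8 + 8) → Bool, ¬ Odd (w p) → w (bxor (bxor p d₄) d₂) - sZ (f (bxor (bxor p d₄) d₂)) = 0 := by
      intro p hp
      rw [iw_bxor_assoc]
      exact hzero p _ hp t5
    have z6 : ∀ p : Fin (8 + 8) → Bool, ¬ Odd (w p) → w (bxor (bxor p d₄) d₁) - sZ (f (bxor (bxor p d₄) d₁)) = 0 := by
      intro p hp
      rw [iw_bxor_assoc]
      exact hzero p _ hp t6
    have z7 : ∀ p : Fin (8 + 8) → Bool, ¬ Odd (w p) → w (bxor (bxor p d₃) d₂) - sZ (f (bxor (bxor p d₃) d₂)) = 0 := by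
      intro p hp
      rw [iw_bxor_assoc]
      exact hzero p _ hp t7
    have z8 : ∀ p : Fin (8 + 8) → Bool, ¬ Odd (w p) → w (bxor (bxor p d₃) d₁) - sZ (f (bxor (bxor p d₃) d₁)) = 0 := by
      intro p hp
      rw [iw_bxor_assoc]
      exact hzero p _ hp t8
    have z9 : ∀ p : Fin (8 + 8) → Bool, ¬ Odd (w p) → w (bxor (bxor p d₂) d₁) - sZ (f (bxor (bxor p d₂) d₁)) = 0 := by
      intro p hp
      rw [iw_bxor_assoc]
      exact hzero p _ hp t9
    have z10 : ∀ p : Fin (8 + 8) → Bool, ¬ Odd (w p) → w (bxor (bxor (bxor p d₄) d₃) d₂) - sZ (f (bxor (bxor (bxor p d₄) d₃) d₂)) = 0 := by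
      intro p hp
      rw [iw_bxor_assoc, iw_bxor_assoc]
      exact hzero p _ hp t10
    have z11 : ∀ p : Fin (8 + 8) → Bool, ¬ Odd (w p) → w (bxor (bxor (bxor p d₄) d₃) d₁) - sZ (f (bxor (bxor (bxor p d₄) d₃) d₁)) = 0 := by
      intro p hp
      rw [iw_bxor_assoc, iw_bxor_assoc]
      exact hzero p _ hp t11
    have z12 : ∀ p : Fin (8 + 8) → Bool, ¬ Odd (w p) → w (bxor (bxor (bxor p d₄) d₂) d₁) - sZ (f (bxor (bxor (bxor p d₄) d₂) d₁)) = 0 := by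
      intro p hp
      rw [iw_bxor_assoc, iw_bxor_assoc]
      exact hzero p _ hp t12
    have z13 : ∀ p : Fin (8 + 8) → Bool, ¬ Odd (w p) → w (bxor (bxor (bxor p d₃) d₂) d₁) - sZ (f (bxor (bxor (bxor p d₃) d₂) d₁)) = 0 := by
      intro p hp
      rw [iw_bxor_assoc, iw_bxor_assoc]
      exact hzero p _ hp t13
    have z14 : ∀ p : Fin (8 + 8) → Bool, ¬ Odd (w p) → w (bxor (bxor (bxor (bxor p d₄) d₃) d₂) d₁) - sZ (f (bxor (bxor (bxor (bxor p d₄) d₃) d₂) d₁)) = 0 := by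
      intro p hp
      rw [iw_bxor_assoc, iw_bxor_assoc, iw_bxor_assoc]
      exact hzero p _ hp t14
    rw [z0 _ o0, z0 _ o1, z0 _ o2, z0 _ o3, z1 _ o0, z1 _ o1, z1 _ o2, z1 _ o3, z2 _ o0, z2 _ o1, z2 _ o2, z2 _ o3, z3 _ o0, z3 _ o1, z3 _ o2, z3 _ o3, z4 _ o0, z4 _ o1, z4 _ o2, z4 _ o3, z5 _ o0, z5 _ o1, z5 _ o2, z5 _ o3, z6 _ o0, z6 _ o1, z6 _ o2, z6 _ o3, z7 _ o0, z7 _ o1, z7 _ o2, z7 _ o3, z8 _ o0, z8 _ o1, z8 _ o2, z8 _ o3, z9 _ o0, z9 _ o1, z9 _ o2, z9 _ o3, z10 _ o0, z10 _ o1, z10 _ o2, z10 _ o3, z11 _ o0, z11 _ o1, z11 _ o2, z11 _ o3, z12 _ o0, z12 _ o1, z12 _ o2, z12 _ o3, z13 _ o0, z13 _ o1, z13 _ o2, z13 _ o3, z14 _ o0, z14 _ o1, z14 _ o2, z14 _ o3] at hσ16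
    have h4 : (4 : ℤ) ∣ (w x₁ - sZ (f x₁)) + (w (bxor x₁ c') - sZ (f (bxor x₁ c'))) +
        (w (bxor x₁ c) - sZ (f (bxor x₁ c))) + (w (bxor (bxor x₁ c') c) - sZ (f (bxor (bxor x₁ c') c))) := by
      omega
    have key := fl_signs_of_four_dvd (hon _ o0) (hon _ o1) (hon _ o2) (hon _ o3) h4
    rw [iw_bxor_assoc, bxor_comm c' c] at key
    rw [key, mul_comm]
  -- the `±`character and its sixteen frequencies
  let A : (Fin (8 + 8) → Bool) → ℝ := fun x => ((w x - sZ (f x) : ℤ) : ℝ)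
  have hAon : ∀ c₀ ∈ V₀, A (bxor x₁ c₀) = 1 ∨ A (bxor x₁ c₀) = -1 := by
    intro c₀ hc₀
    rcases hon _ (hin _ hx₁ c₀ hc₀) with h | h
    · left; simp only [A, h]; norm_num
    · right; simp only [A, h]; norm_num
  have hmulA : ∀ c₀ ∈ V₀, ∀ c₀' ∈ V₀, A (bxor x₁ (bxor c₀ c₀')) * A x₁ = A (bxor x₁ c₀) * A (bxor x₁ c₀') := by
    intro c₀ hc₀ c₀' hc₀'
    simp only [A]
    exact_mod_cast hmul c₀ hc₀ c₀' hc₀'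
  have hAoff : ∀ x, Odd (w x) → A x = 0 := by
    intro x hx; simp only [A, hoff x hx]; norm_num
  have hWA : ∀ y, W A y = 0 ∨ W A y = 4096 ∨ W A y = -4096 := by
    intro y
    have hsplit : W A y = ∑ c₀ ∈ V₀, A (bxor x₁ c₀) * twist (bxor x₁ c₀) y := by
      unfold W
      rw [← sum_filter_add_sum_filter_not univ (fun x : Fin (8 + 8) → Bool => ¬ Odd (w x))]
      have hz : ∑ x ∈ univ.filter (fun x : Fin (8 + 8) → Bool => ¬ ¬ Odd (w x)), A x * twist x y = 0 := by
        refine sum_eq_zero fun x hx => ?_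
        have hx' : Odd (w x) := by simpa using (mem_filter.1 hx).2
        rw [hAoff x hx', zero_mul]
      rw [hz, add_zero, hPimg, sum_image fun a _ b _ hab => by simpa only [bxor_bxor_cancel_left] using congrArg (bxor x₁) hab]
    obtain ⟨r, hr, hsum⟩ := fl_char_coset V₀ h0 hadd x₁ A hAon hmulA y
    rw [hsplit, hsum, hcardV, hZcard]
    rcases hr with h | h | h <;> rw [h] <;> norm_num
  have hPA : ∑ y, W A y ^ 2 = (2 : ℝ) ^ (8 + 8) * 4096 := by
    rw [sum_W_sq]
    congr 1
    have hsq : ∀ x, A x ^ 2 = ((if ¬ Odd (w x) then 1 else 0 : ℤ) : ℝ) := by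
      intro x
      by_cases hx : Odd (w x)
      · rw [if_neg (not_not.2 hx), hAoff x hx]; norm_num
      · rw [if_pos hx]; rcases hon x hx with h | h <;> simp only [A, h] <;> norm_num
    rw [sum_congr rfl fun x _ => hsq x, ← Int.cast_sum, hsumP, hZcard]
    norm_num
  -- Walsh inversion: `Â = 256(−1)^g − W_f`
  have hinv : ∀ y, ∑ x, (w x : ℝ) * twist x y = 256 * signOf (g y) := by
    intro y
    have h := tz_inversion (fun z => signOf (g z)) y
    rw [sum_congr rfl fun x _ => by rw [hw x]] at h
    have e : ∑ x, (2 : ℝ) ^ 8 * (w x : ℝ) * twist x y = 2 ^ 8 * ∑ x, (w x : ℝ) * twist x y := by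
      rw [mul_sum]
      exact sum_congr rfl fun x _ => by ring
    rw [e] at h
    have h' : (2 : ℝ) ^ 8 * (∑ x, (w x : ℝ) * twist x y - 256 * signOf (g y)) = 0 := by
      rw [mul_sub, h]; norm_num; ring
    have h2 : (2 : ℝ) ^ 8 ≠ 0 := by positivity
    linarith [(mul_eq_zero.1 h').resolve_left h2]
  have hFour : ∀ y, W A y = 256 * signOf (g y) - W (fun x => signOf (f x)) y := by
    intro y
    unfold W
    have e : ∀ x, A x * twist x y = (w x : ℝ) * twist x y - signOf (f x) * twist x y := by
      intro x
      simp only [A]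
      push_cast
      rw [tp_sZ_cast]
      ring
    rw [sum_congr rfl fun x _ => e x, sum_sub_distrib, hinv y]
  -- Parseval for `f` forces `Σ (−1)^g Â = 2¹⁹` …
  have hPf := st_parseval16 f
  have hSg : ∑ y, signOf (g y) * W A y = 524288 := by
    have e : ∀ y, W (fun x => signOf (f x)) y ^ 2 = 65536 - 512 * (signOf (g y) * W A y) + W A y ^ 2 := by
      intro y
      have hs2 : signOf (g y) ^ 2 = 1 := signOf_sq _
      have hW' : W (fun x => signOf (f x)) y = 256 * signOf (g y) - W A y := by rw [hFour y]; ring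
      rw [hW']
      nlinarith [hs2]
    have hsum := hPf
    rw [sum_congr rfl fun y _ => e y, sum_add_distrib, sum_sub_distrib, sum_const, card_univ, Fintype.card_fun,
      Fintype.card_bool, Fintype.card_fin, nsmul_eq_mul, ← mul_sum, hPA] at hsum
    set S := ∑ y, signOf (g y) * W A y with hS
    norm_num at hsum
    linarith
  -- … but sixteen frequencies of modulus `2¹²` pair to at most `2¹⁶`
  have hbound := fl_abs_sum_le (W A) (fun y => signOf (g y)) (by norm_num : (0 : ℝ) < 4096) hWA
    (fun y => by unfold signOf; split_ifs <;> norm_num)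
  rw [hPA, hSg] at hbound
  norm_num at hbound

end Summit.QuantumAdvantage.QuantumAdvantage.Theorems.CubicForrelation.NearExactIsExact

end
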